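import Summits.AnomalousDissipation.AnomalousDissipation.Theorems.SolenoidalFractalHomogenisationLagrangianStepVmodFrameSolDefs
import Summits.AnomalousDissipation.AnomalousDissipation.Theorems.SolenoidalFractalHomogenisationLagrangianStepFrameModulationF
import Summits.AnomalousDissipation.AnomalousDissipation.Theorems.SolenoidalFractalHomogenisationLagrangianStepFrameConjugacyFS
import Summits.AnomalousDissipation.AnomalousDissipation.Theorems.SolenoidalFractalHomogenisationLagrangianStepZ7GlueEulerXOfVRH0
import HarnessLib

/-!
# K1L_D (stmt-AnomalousDissipation-27980), (ℓ3) LINE HEAD OVER THE CLASS OF RECORD, v2 PROPAGATOR SPEC `IsDistortedPropagatorS` (RULING D28-10 (c)):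
# `Z7Glue.vmod_EX_of_VRH0FS X e he : ⟨∀ design data: (V) → X → W7 → ∃ θ₁ ϱ₁ Cm, C ≤ Cm ∧ VmodDist.SlowVectorClauseModECW0FS … (e σ) Cm ν₀ K θ₁ ϱ₁⟩ → Z7Glue.Vmod_E_textHTX X e`
(helper, `--supports 27980 --as helper`; prover lead-k1l-onelevel-p1 g7; memo L21 `Cruxes/…/Lines/onelevel-L21-ell3A-recut.md`.)

PORT of `…Z7GlueEulerXOfVRH0F` (p720877): the bracket now concludes the modulated clause over FRAME modulations AND v2 propagators (`IsDistortedPropagator ∧ exists_sol`), which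
is what the (ℓ3-A) assembly `VmodDist.modECW0FS_of_blockBoundsGFS_at` (`…VmodFrameSolAssembly`) delivers from the four distorted blocks `BlockBoundGFS` and
(M_θ) `NearMultGFS`; the frame is supplied by `FrameForm.isFrameModulation_frameG_closed_pos` (`…FrameModulationF`) and conjugated by
`FrameConj.frameConjugacyAtFS_of_modulation` (`…FrameConjugacyFS`).  With this file the v28 registered stub
`stub_Vmod_EHTthg : Vmod_E_textHTX Xθg (fun σ => min (σ/2) (1/2))` is BY NAME `vmod_EX_of_VRH0FS Z7Glue.Xθg _ _ ⟨(V)+(Xθg)+W7 ⇒ ∃ θ₁ ϱ₁ Cm, ModECW0FS⟩`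
— NO registry move (v28 stands).
* `eulerian_pieceW_lam0FS` — `eulerian_pieceW_lam0` with `hMod : VmodDist.SlowVectorClauseModECW0FS …`, `hFC : FrameConjugacyAtFS …`;
* `vmod_EX_of_VRH0FS` — the certificate (proof verbatim: constants `θ₁' = min (min θs₁ θs₂) (θ₁/Cα)`, `ϱ₁' = ϱ₁/ϱ`, `Cm' = Cm·Lσ`).
No sorry, no definition, no named fact.  NOT a proof of `stub_Vmod_EHTthg`, K1L_D or AD; rung F-D1.A0.
-/

set_option linter.dupNamespace false

noncomputable section

namespace Summit.AnomalousDissipation.AnomalousDissipation.Theorems.SolenoidalFractalHomogenisation.LagrangianStep.Z7Glue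

open Literature.Analysis Literature.Analysis.FluidPDE Literature.Analysis.FunctionSpaces
open MeasureTheory Set
open scoped InnerProductSpace
open Literature.Analysis.FluidPDE.LatticeShear (LagrangianLatticeCarrier LatticeWord)
open Summit.AnomalousDissipation.AnomalousDissipation.Theorems.SolenoidalFractalHomogenisation.LagrangianStep.CellClauseMod
open Summit.AnomalousDissipation.AnomalousDissipation.Theorems.SolenoidalFractalHomogenisation.LagrangianStep.FrameConj
open Summit.AnomalousDissipation.AnomalousDissipation.Theorems.SolenoidalFractalHomogenisation.LagrangianStep.FrameForm

/-- **`eulerian_pieceW_lam0` over the class of record**: VERBATIM with `hMod : VmodDist.SlowVectorClauseModECW0FS …` and `hFC : FrameConjugacyAtFS …`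
(the clause is applied at the frame-modulation datum). -/
theorem eulerian_pieceW_lam0FS {k : ℕ} {W : LatticeWord k} {M : ℝ} {hM : 0 < M} {c : ℝ}
    {Φ : ℝ → Torus.Visc4 (Fin 3) → Torus.Visc4 (Fin 3)} {lo hi Λ β σ Cm ν₀ K θ₁ ϱ₁ Cα ϱ : ℝ}
    {E : LagrangianLatticeCarrier k} {m : ℕ} {S : Torus.Visc4 (Fin 3)} {Um1 Um : ℝ → ℝ → (V2 →L[ℝ] V2)} {s t : ℝ}
    {bm bm1 : ℝ → VF} {𝔸m 𝔸m1 : Torus.Visc4 (Fin 3)} {T₀ : ℝ}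
    (hMod : VmodDist.SlowVectorClauseModECW0FS W M hM c Φ lo hi Λ β σ Cm ν₀ K θ₁ ϱ₁)
    (hFC : FrameConjugacyAtFS W M hM c Φ Cα ϱ E m S Um1 Um s t)
    (hUm : Torus.IsPropagator T₀ bm 𝔸m Um) (hUm1 : Torus.IsPropagator T₀ bm1 𝔸m1 Um1)
    (hst : s < t) (hσ : 0 < σ) (hCm : 0 ≤ Cm) (hϱ : 0 ≤ ϱ)
    (hνν₀ : E.cellVisc (m + 1) < ν₀) (hKn : (⌈K / E.cellVisc (m + 1)⌉₊ : ℝ) ≤ E.N (m + 1))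
    (hθθ₁ : Cα * E.θ (m + 1) ≤ θ₁) (hϱϱ₁ : ϱ * E.N m ≤ ϱ₁ * E.N (m + 1))
    (hSo : Torus.OddSmall S β) (hSw : ∃ lam ∈ Set.Icc (1:ℝ) Λ, Torus.NearIso S (lo / lam) (hi * lam))
    (hΦSo : Torus.OddSmall (Φ (E.cellVisc (m + 1)) S) β)
    (hΦSw : ∃ lam ∈ Set.Icc (1:ℝ) Λ, Torus.NearIso (Φ (E.cellVisc (m + 1)) S) (lo / lam) (hi * lam)) :
    ∀ x y : V2, |⟪Um1 s t x - Um s t x, y⟫_ℝ|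
      ≤ (Cm * (Cm * (E.cellVisc (m + 1) ^ σ + ((⌈K / E.cellVisc (m + 1)⌉₊ : ℝ) / E.N (m + 1)) ^ σ
            + (Cα * E.θ (m + 1)) ^ σ + (ϱ * E.N m / E.N (m + 1)) ^ σ)
          + (min 1 ((M * W.period / E.cellVisc (m + 1)) / (E.a (m + 1) * (t - s)))) ^ σ))
        * Real.sqrt (lossFwd (Um s t) x) * Real.sqrt (lossAdj (Um s t) y) := by
  obtain ⟨hν, θ, hθ0, hθle, nC, hnC0, hnCle, G, hG, Ut, Tt, hUt, hTt, ι, ι', hconj, hlossF, hlossA⟩ := hFC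
  -- abbreviations
  set ν : ℝ := E.cellVisc (m + 1) with hν_def
  set Tw : ℝ := E.a (m + 1) * (t - s) with hTw_def
  have hνI : ν ∈ Set.Ioo 0 ν₀ := ⟨hν.1, hνν₀⟩
  have ha : 0 < E.a (m + 1) := E.a_pos (m + 1)
  have hTw : 0 < Tw := mul_pos ha (by linarith)
  have hn : (0:ℝ) < E.N (m + 1) := by exact_mod_cast E.N_pos (m + 1)
  -- the (V)-family member `𝔸 = ν • S`, `λ = 1`
  have hodd : Torus.OddSmall (ν • S) (ν * β) := hSo.smul ν
  have hwin : ∃ lam ∈ Set.Icc (1:ℝ) Λ, Torus.NearIso (ν • S) (ν * (lo / lam)) (ν * (hi * lam)) := by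
    obtain ⟨lam, hlam, hS⟩ := hSw
    exact ⟨lam, hlam, hS.smul hν.1.le⟩
  have hsm : (1 / ν) • (ν • S) = S := by rw [smul_smul, one_div_mul_cancel hν.1.ne', one_smul]
  have hΦo : Torus.OddSmall (Φ ν ((1 / ν) • (ν • S))) β := by rw [hsm]; exact hΦSo
  have hΦw : ∃ lam ∈ Set.Icc (1:ℝ) Λ, Torus.NearIso (Φ ν ((1 / ν) • (ν • S))) (lo / lam) (hi * lam) := by
    rw [hsm]; exact hΦSw
  have hθI : θ ∈ Set.Icc 0 θ₁ := ⟨hθ0, hθle.trans hθθ₁⟩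
  have hnCn : nC ≤ ϱ₁ * (E.N (m + 1) : ℕ) := hnCle.trans hϱϱ₁
  -- the clause, at the frame data
  have key := hMod ν hνI (E.N (m + 1)) hKn (ν • S) hodd hwin hΦo hΦw θ hθI nC hnC0 hnCn Tw hTw G hG Ut Tt hUt hTt Tw hTw le_rfl
  -- the error functional and its monotone envelope
  set η : ℝ := Cm * (Cm * (ν ^ σ + ((⌈K / ν⌉₊ : ℝ) / (E.N (m + 1) : ℕ)) ^ σ + θ ^ σ + (nC / (E.N (m + 1) : ℕ)) ^ σ)
      + (min 1 ((M * W.period / ν) / Tw)) ^ σ) with hη_def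
  set ηbar : ℝ := Cm * (Cm * (ν ^ σ + ((⌈K / ν⌉₊ : ℝ) / E.N (m + 1)) ^ σ + (Cα * E.θ (m + 1)) ^ σ + (ϱ * E.N m / E.N (m + 1)) ^ σ)
      + (min 1 ((M * W.period / ν) / Tw)) ^ σ) with hηbar_def
  have hηle : η ≤ ηbar := by
    rw [hη_def, hηbar_def]
    exact eta_mono hCm hσ.le hθ0 hθle (div_nonneg hnC0 hn.le) (div_le_div_of_nonneg_right hnCle hn.le)
  have hηbar0 : 0 ≤ ηbar := by
    rw [hηbar_def]
    have h1 : 0 ≤ ν ^ σ := Real.rpow_nonneg hν.1.le σ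
    have h2 : 0 ≤ ((⌈K / ν⌉₊ : ℝ) / E.N (m + 1)) ^ σ := Real.rpow_nonneg (by positivity) σ
    have h3 : 0 ≤ (Cα * E.θ (m + 1)) ^ σ := Real.rpow_nonneg (hθ0.trans hθle) σ
    have h4 : 0 ≤ (ϱ * E.N m / E.N (m + 1)) ^ σ := Real.rpow_nonneg (by positivity) σ
    have hWp : 0 < W.period := PermissibleCarrier.period_pos W
    have h5 : 0 ≤ (min 1 ((M * W.period / ν) / Tw)) ^ σ :=
      Real.rpow_nonneg (le_min zero_le_one (div_nonneg (div_nonneg (mul_nonneg hM.le hWp.le) hν.1.le) hTw.le)) σ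
    have : 0 ≤ Cm * (ν ^ σ + ((⌈K / ν⌉₊ : ℝ) / E.N (m + 1)) ^ σ + (Cα * E.θ (m + 1)) ^ σ + (ϱ * E.N m / E.N (m + 1)) ^ σ) :=
      mul_nonneg hCm (by linarith)
    exact mul_nonneg hCm (by linarith)
  -- divergence-free data: conjugate, apply the clause, read back
  have hdiv : ∀ x y : V2, Torus.IsWeaklyDivFree (⇑x : VF) → Torus.IsWeaklyDivFree (⇑y : VF) →
      |⟪Um1 s t x - Um s t x, y⟫_ℝ| ≤ ηbar * Real.sqrt (lossFwd (Um s t) x) * Real.sqrt (lossAdj (Um s t) y) := by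
    intro x y hx hy
    rw [hconj x y hx hy, ← hlossF x hx, ← hlossA y hy]
    refine (key (ι x) (ι' y)).trans ?_
    exact mul_le_mul (mul_le_mul_of_nonneg_right hηle (Real.sqrt_nonneg _)) le_rfl (Real.sqrt_nonneg _)
      (mul_nonneg hηbar0 (Real.sqrt_nonneg _))
  -- all data
  exact lossBound_of_divFree_propagator hUm hUm1 s t hηbar0 hdiv


/-! ## §2 The certificate -/

set_option maxHeartbeats 800000 in
/-- **The (ℓ3) line head over the CLASS OF RECORD (D28-8′)**: `vmod_EX_of_VRH0` (p715838) VERBATIM except that the bracket concludes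
`VmodDist.SlowVectorClauseModECW0FS` (frame modulations: clamped · rate · holonomic) and the frame is supplied by
`FrameForm.isFrameModulation_frameG_closed_pos` / `FrameConj.frameConjugacyAtFS_of_modulation`.  Original docstring: if for every design datum (V), `X` and the W7
family give constants `θ₁ ϱ₁ Cm` with `VmodDist.SlowVectorClauseModECW0 … (e σ) Cm ν₀ K θ₁ ϱ₁`, then `Vmod_E_textHTX X e`.  Proof = `vmod_E_of_VRH`
(p710278) verbatim with `eulerian_pieceW_lam0` (frame = modulation datum; conjugation with losses preserved; read-back); constants
`θ₁' = min (min θs₁ θs₂) (θ₁/Cα)`, `ϱ₁' = ϱ₁/ϱ`, `Cm' = Cm * Lσ`, `Lσ := max 1 (max Cα ϱ) ^ (e σ)`. -/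

theorem vmod_EX_of_VRH0FS
    (X : ∀ {k : ℕ}, LatticeWord k → (M : ℝ) → 0 < M → ℝ → (ℝ → Torus.Visc4 (Fin 3) → Torus.Visc4 (Fin 3)) → ℝ → ℝ → ℝ → ℝ → ℝ → ℝ → ℝ → ℝ → Prop)
    (e : ℝ → ℝ) (he : ∀ σ : ℝ, 0 < σ → 0 < e σ)
    (H : ∀ k (W : LatticeWord k) (M : ℝ) (hM : 0 < M) (c : ℝ), 0 < c →
      ∀ (Φ : ℝ → Torus.Visc4 (Fin 3) → Torus.Visc4 (Fin 3)) (lo hi Λ β σ C ν₀ K : ℝ),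
        0 < lo → lo ≤ 1 → 1 ≤ hi → 1 < Λ → 0 ≤ β → 0 < σ → 0 ≤ C → 0 < ν₀ → ν₀ ≤ 1 → 0 < K →
        SlowVectorClauseF W M hM c Φ lo hi Λ β σ C ν₀ K →
        X W M hM c Φ lo hi Λ β σ C ν₀ K →
        (∀ Kb : ℝ, 1 ≤ Kb → ∃ CK : ℝ, 1 ≤ CK ∧ ∃ cK > (0:ℝ), ∃ νh > (0:ℝ), HighLabelDecayW W M hM lo hi Λ β νh Kb CK cK) →
        ∃ θ₁ > (0:ℝ), ∃ ϱ₁ > (0:ℝ), ∃ Cm : ℝ, C ≤ Cm ∧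
          VmodDist.SlowVectorClauseModECW0FS W M hM c Φ lo hi Λ β (e σ) Cm ν₀ K θ₁ ϱ₁) :
    Vmod_E_textHTX X e := by
  intro k W M hM c hc Φ lo hi Λ β σ C ν₀ K hlo hlo1 hhi hΛ hβ hσ hC hν₀ hν₀1 hK hV hXv hH
  obtain ⟨θ₁, hθ₁, ϱ₁, hϱ₁, Cm, hCCm, hMod⟩ := H k W M hM c hc Φ lo hi Λ β σ C ν₀ K hlo hlo1 hhi hΛ hβ hσ hC hν₀ hν₀1 hK hV hXv hH
  set σ' : ℝ := e σ with hσ'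
  have hσ'0 : 0 < σ' := he σ hσ
  have hCm : 0 ≤ Cm := hC.trans hCCm
  -- the frame ceilings of the design
  obtain ⟨θs₁, hθs₁, Cα, hCα, Hmod⟩ := isFrameModulation_frameG_closed_pos k (W.stretch M hM)
  obtain ⟨θs₂, hθs₂, Cs, hCs, Hcurv⟩ := abs_partialDeriv_frameG_le k (W.stretch M hM)
  set ϱ : ℝ := (Cs + 1) / Cα with hϱdef
  have hϱ : 0 < ϱ := by rw [hϱdef]; positivity
  -- the clause's constants
  set L : ℝ := max 1 (max Cα ϱ) with hLdef
  have hL1 : 1 ≤ L := le_max_left _ _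
  have hCαL : Cα ≤ L := (le_max_left _ _).trans (le_max_right _ _)
  have hϱL : ϱ ≤ L := (le_max_right _ _).trans (le_max_right _ _)
  set Lσ : ℝ := L ^ σ' with hLσ
  have hLσ1 : 1 ≤ Lσ := by rw [hLσ]; exact Real.one_le_rpow hL1 hσ'0.le
  refine ⟨min (min θs₁ θs₂) (θ₁ / Cα), lt_min (lt_min hθs₁ hθs₂) (div_pos hθ₁ hCα), ϱ₁ / ϱ, div_pos hϱ₁ hϱ, Cm * Lσ,
    hCCm.trans (le_mul_of_one_le_right hCm hLσ1), ?_⟩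
  intro E hdes hgain hLP hReg hN2 hT4 m hνν₀ hKn hNle S hSo hSw hΦSo hΦSw Um Um1 hUm hUm1 j s t hs hst htR ht1 x y
  -- level data
  have hLR := hReg.levelRegular
  set R : ℝ := E.refresh (m + 1) with hRdef
  have hR : 0 < R := E.refresh_pos (m + 1)
  set ν : ℝ := E.cellVisc (m + 1) with hνdef
  have hν : 0 < ν := LagrangianRenormalisationStep.cellVisc_pos' E.toFractalCarrierData (m + 1)
  have hj0 : 0 ≤ (j : ℝ) * R := mul_nonneg (Nat.cast_nonneg j) hR.le
  have hκ0 : 0 < E.kbar m := E.kbar_pos m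
  have hκ1 : 0 < E.kbar (m + 1) := E.kbar_pos (m + 1)
  have hg : 0 ≤ E.gain / ν ^ 2 := div_nonneg (by rw [hgain]; exact hc.le) (sq_nonneg _)
  have hT4₁ : ∀ m, E.θ (m + 1) * ((E.N (m + 1) : ℝ) / E.N m) ^ (1 / 16 : ℝ) ≤ θs₁ := fun m =>
    (hT4 m).trans ((min_le_left _ _).trans (min_le_left _ _))
  have hT4₂ : ∀ m, E.θ (m + 1) * ((E.N (m + 1) : ℝ) / E.N m) ^ (1 / 16 : ℝ) ≤ θs₂ := fun m =>
    (hT4 m).trans ((min_le_left _ _).trans (min_le_right _ _))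
  have hθm : E.θ (m + 1) ≤ θ₁ / Cα := (theta_le_of_template E hLP hT4 m).trans (min_le_right _ _)
  have hθθ₁ : Cα * E.θ (m + 1) ≤ θ₁ := by
    calc Cα * E.θ (m + 1) ≤ Cα * (θ₁ / Cα) := mul_le_mul_of_nonneg_left hθm hCα.le
      _ = θ₁ := by field_simp
  have hNm : (0 : ℝ) < E.N m := by exact_mod_cast E.N_pos m
  have hϱϱ₁ : ϱ * E.N m ≤ ϱ₁ * E.N (m + 1) := by
    have h := mul_le_mul_of_nonneg_left hNle hϱ.le
    calc ϱ * E.N m ≤ ϱ * (ϱ₁ / ϱ * E.N (m + 1)) := h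
      _ = ϱ₁ * E.N (m + 1) := by field_simp
  -- the two Eulerian tensors are elliptic (common window `lo/Λ, hi·Λ`)
  have hΛ0 : 0 < Λ := by linarith
  obtain ⟨lam, hlam, hSn⟩ := hSw
  obtain ⟨lam', hlam', hΦSn⟩ := hΦSw
  have hlam0 : 0 < lam := by linarith [hlam.1]
  have hlam'0 : 0 < lam' := by linarith [hlam'.1]
  have hhi0 : 0 ≤ hi := by linarith
  have hSn' : Torus.NearIso S (lo / Λ) (hi * Λ) :=
    hSn.mono (div_le_div_of_nonneg_left hlo.le hlam0 hlam.2) (mul_le_mul_of_nonneg_left hlam.2 hhi0)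
  have hΦSn' : Torus.NearIso (Φ ν S) (lo / Λ) (hi * Λ) :=
    hΦSn.mono (div_le_div_of_nonneg_left hlo.le hlam'0 hlam'.2) (mul_le_mul_of_nonneg_left hlam'.2 hhi0)
  have hloΛ : 0 < lo / Λ := div_pos hlo hΛ0
  have h𝔸1 : Torus.NearIso (E.kbar (m + 1) • S) (E.kbar (m + 1) * (lo / Λ)) (E.kbar (m + 1) * (hi * Λ)) := hSn'.smul hκ1.le
  have hlo₁ : 0 < E.kbar (m + 1) * (lo / Λ) := mul_pos hκ1 hloΛ
  have h𝔸0 : Torus.NearIso (E.kbar m • renormStep (Φ ν) (E.gain / ν ^ 2) S) (E.kbar m * (lo / Λ)) (E.kbar m * (hi * Λ)) :=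
    (nearIso_renormStep hg hSn' hΦSn').smul hκ0.le
  have hlo₀ : 0 < E.kbar m * (lo / Λ) := mul_pos hκ0 hloΛ
  -- hmod on the closed piece `[jR, t]` from K8-5
  have hstrain0 : 0 ≤ E.strain m := by
    unfold LagrangianLatticeCarrier.strain
    exact mul_nonneg (Finset.sum_nonneg fun i _ => (E.toFractalCarrierData.a_pos (i + 1)).le) (E.refresh_pos (m + 1)).le
  have hjt : (j : ℝ) * R < t := by rw [← hs]; exact hst
  have htR' : t ≤ (j : ℝ) * R + R := by rw [← hs]; exact htR
  have htR'' : t ≤ ((j : ℝ) + 1) * R := by rw [add_one_mul]; exact htR'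
  have hmod : IsFrameModulation (Cα * E.strain m) (E.a (m + 1) * (t - (j : ℝ) * R)) (ϱ * E.N m)
      (fun τ y => frameG E m ((j : ℝ) * R + max 0 (min τ (E.a (m + 1) * (t - (j : ℝ) * R))) / E.a (m + 1)) ((j : ℝ) * R) y) := by
    have hc' : ∀ u ∈ Icc 0 (t - ((j : ℤ) : ℝ) * E.refresh (m + 1)), ∀ (y : UnitAddTorus (Fin 3)) (i l c : Fin 3),
        |Torus.partialDeriv c (fun y => frameG E m (((j : ℤ) : ℝ) * E.refresh (m + 1) + u) (((j : ℤ) : ℝ) * E.refresh (m + 1)) y i l) y|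
          ≤ (Cα * E.strain m) * (ϱ * E.N m) := by
      intro u hu y i l c'
      have h := Hcurv E _ hdes (le_refl θs₂) hLP hReg hN2 hT4₂ m (j : ℤ) t (by push_cast; exact hjt) (by push_cast; exact htR'') u hu y i l c'
      refine h.trans ?_
      have e1 : Cα * E.strain m * (ϱ * E.N m) = (Cs + 1) * E.N m * E.strain m := by
        rw [hϱdef]; field_simp
      rw [e1]
      exact mul_le_mul_of_nonneg_right (mul_le_mul_of_nonneg_right (by linarith) hNm.le) hstrain0
    have h := Hmod E _ hdes (le_refl θs₁) hLP hReg hN2 hT4₁ m (j : ℤ) t (by push_cast; exact hjt) (by push_cast; exact htR'') (ϱ * E.N m) hc'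
    push_cast at h
    exact h
  have hθle : Cα * E.strain m ≤ Cα * E.θ (m + 1) := mul_le_mul_of_nonneg_left (hLP.strain_le m) hCα.le
  have hθ0 : 0 ≤ Cα * E.strain m := mul_nonneg hCα.le hstrain0
  -- the conjugacy on the piece, then step (a)
  have hFC := FrameConj.frameConjugacyAtFS_of_modulation E hLP hLR hdes Φ m j S hj0 hjt htR' ht1 hν hθ0 hθle hϱ.le hmod hUm1 hUm h𝔸1 hlo₁ h𝔸0 hlo₀
  rw [hgain] at hFC
  subst hs
  have key := eulerian_pieceW_lam0FS hMod hFC hUm hUm1 hst hσ'0 hCm hϱ.le hνν₀ hKn hθθ₁ hϱϱ₁ hSo ⟨lam, hlam, hSn⟩ hΦSo ⟨lam', hlam', hΦSn⟩ x y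
  refine key.trans ?_
  -- absorb `Cα`, `ϱ` into `Cm' = Cm·Lσ`
  have hθpos : 0 ≤ E.θ (m + 1) := (E.θ_pos _).le
  have hN : (0:ℝ) < E.N (m + 1) := by exact_mod_cast E.N_pos (m + 1)
  have hρ0 : 0 ≤ (E.N m : ℝ) / E.N (m + 1) := by positivity
  have h1 : (Cα * E.θ (m + 1)) ^ σ' ≤ Lσ * E.θ (m + 1) ^ σ' := by rw [hLσ]; exact mul_rpow_le_of_le hCα.le hCαL hθpos hσ'0
  have h2 : (ϱ * E.N m / E.N (m + 1)) ^ σ' ≤ Lσ * ((E.N m : ℝ) / E.N (m + 1)) ^ σ' := by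
    rw [hLσ, mul_div_assoc]; exact mul_rpow_le_of_le hϱ.le hϱL hρ0 hσ'0
  have hA0 : 0 ≤ ν ^ σ' := Real.rpow_nonneg hν.le σ'
  have hB0 : 0 ≤ ((⌈K / ν⌉₊ : ℝ) / E.N (m + 1)) ^ σ' := Real.rpow_nonneg (by positivity) σ'
  have hθσ : 0 ≤ E.θ (m + 1) ^ σ' := Real.rpow_nonneg hθpos σ'
  have hρσ : 0 ≤ ((E.N m : ℝ) / E.N (m + 1)) ^ σ' := Real.rpow_nonneg hρ0 σ'
  have hP0 : 0 ≤ (M * W.period / ν) / (E.a (m + 1) * (t - (j : ℝ) * E.refresh (m + 1))) := by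
    have hWp : 0 < W.period := PermissibleCarrier.period_pos W
    have : 0 < t - (j : ℝ) * E.refresh (m + 1) := by linarith
    have := E.a_pos (m + 1)
    positivity
  have hT0 : 0 ≤ (min 1 ((M * W.period / ν) / (E.a (m + 1) * (t - (j : ℝ) * E.refresh (m + 1))))) ^ σ' := Real.rpow_nonneg (le_min zero_le_one hP0) σ'
  have hsq0 : 0 ≤ Real.sqrt (lossFwd (Um ((j : ℝ) * E.refresh (m + 1)) t) x) * Real.sqrt (lossAdj (Um ((j : ℝ) * E.refresh (m + 1)) t) y) := by positivity
  -- the inner sum and the whole functional are monotone in the constants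
  have hinner : ν ^ σ' + ((⌈K / ν⌉₊ : ℝ) / E.N (m + 1)) ^ σ' + (Cα * E.θ (m + 1)) ^ σ' + (ϱ * E.N m / E.N (m + 1)) ^ σ'
      ≤ Lσ * (ν ^ σ' + ((⌈K / ν⌉₊ : ℝ) / E.N (m + 1)) ^ σ' + E.θ (m + 1) ^ σ' + ((E.N m : ℝ) / E.N (m + 1)) ^ σ') := by
    have h3 : ν ^ σ' ≤ Lσ * ν ^ σ' := le_mul_of_one_le_left hA0 hLσ1
    have h4 : ((⌈K / ν⌉₊ : ℝ) / E.N (m + 1)) ^ σ' ≤ Lσ * ((⌈K / ν⌉₊ : ℝ) / E.N (m + 1)) ^ σ' := le_mul_of_one_le_left hB0 hLσ1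
    nlinarith
  have hCmL : 0 ≤ Cm * Lσ := mul_nonneg hCm (le_trans zero_le_one hLσ1)
  have hS0 : 0 ≤ ν ^ σ' + ((⌈K / ν⌉₊ : ℝ) / E.N (m + 1)) ^ σ' + E.θ (m + 1) ^ σ' + ((E.N m : ℝ) / E.N (m + 1)) ^ σ' := by linarith
  calc (Cm * (Cm * (ν ^ σ' + ((⌈K / ν⌉₊ : ℝ) / E.N (m + 1)) ^ σ' + (Cα * E.θ (m + 1)) ^ σ' + (ϱ * E.N m / E.N (m + 1)) ^ σ')
          + (min 1 ((M * W.period / ν) / (E.a (m + 1) * (t - (j : ℝ) * E.refresh (m + 1))))) ^ σ'))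
        * Real.sqrt (lossFwd (Um ((j : ℝ) * E.refresh (m + 1)) t) x) * Real.sqrt (lossAdj (Um ((j : ℝ) * E.refresh (m + 1)) t) y)
      = (Cm * (Cm * (ν ^ σ' + ((⌈K / ν⌉₊ : ℝ) / E.N (m + 1)) ^ σ' + (Cα * E.θ (m + 1)) ^ σ' + (ϱ * E.N m / E.N (m + 1)) ^ σ')
          + (min 1 ((M * W.period / ν) / (E.a (m + 1) * (t - (j : ℝ) * E.refresh (m + 1))))) ^ σ'))
        * (Real.sqrt (lossFwd (Um ((j : ℝ) * E.refresh (m + 1)) t) x) * Real.sqrt (lossAdj (Um ((j : ℝ) * E.refresh (m + 1)) t) y)) := by ring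
    _ ≤ (Cm * Lσ * (Cm * Lσ * (ν ^ σ' + ((⌈K / ν⌉₊ : ℝ) / E.N (m + 1)) ^ σ' + E.θ (m + 1) ^ σ' + ((E.N m : ℝ) / E.N (m + 1)) ^ σ')
          + (min 1 ((M * W.period / ν) / (E.a (m + 1) * (t - (j : ℝ) * E.refresh (m + 1))))) ^ σ'))
        * (Real.sqrt (lossFwd (Um ((j : ℝ) * E.refresh (m + 1)) t) x) * Real.sqrt (lossAdj (Um ((j : ℝ) * E.refresh (m + 1)) t) y)) := by
        refine mul_le_mul_of_nonneg_right ?_ hsq0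
        -- `Cm·(Cm·A + T) ≤ CmL·(CmL·A' + T)` with `A ≤ Lσ A'`, `Cm ≤ CmL`
        have hCmle : Cm ≤ Cm * Lσ := le_mul_of_one_le_right hCm hLσ1
        have step1 : Cm * (ν ^ σ' + ((⌈K / ν⌉₊ : ℝ) / E.N (m + 1)) ^ σ' + (Cα * E.θ (m + 1)) ^ σ' + (ϱ * E.N m / E.N (m + 1)) ^ σ')
            ≤ Cm * Lσ * (ν ^ σ' + ((⌈K / ν⌉₊ : ℝ) / E.N (m + 1)) ^ σ' + E.θ (m + 1) ^ σ' + ((E.N m : ℝ) / E.N (m + 1)) ^ σ') := by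
          have := mul_le_mul_of_nonneg_left hinner hCm
          linarith [this]
        have step2 : Cm * (Cm * (ν ^ σ' + ((⌈K / ν⌉₊ : ℝ) / E.N (m + 1)) ^ σ' + (Cα * E.θ (m + 1)) ^ σ' + (ϱ * E.N m / E.N (m + 1)) ^ σ')
              + (min 1 ((M * W.period / ν) / (E.a (m + 1) * (t - (j : ℝ) * E.refresh (m + 1))))) ^ σ')
            ≤ Cm * (Cm * Lσ * (ν ^ σ' + ((⌈K / ν⌉₊ : ℝ) / E.N (m + 1)) ^ σ' + E.θ (m + 1) ^ σ' + ((E.N m : ℝ) / E.N (m + 1)) ^ σ')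
              + (min 1 ((M * W.period / ν) / (E.a (m + 1) * (t - (j : ℝ) * E.refresh (m + 1))))) ^ σ') :=
          mul_le_mul_of_nonneg_left (by linarith [step1]) hCm
        refine step2.trans ?_
        have hin0 : 0 ≤ Cm * Lσ * (ν ^ σ' + ((⌈K / ν⌉₊ : ℝ) / E.N (m + 1)) ^ σ' + E.θ (m + 1) ^ σ' + ((E.N m : ℝ) / E.N (m + 1)) ^ σ')
            + (min 1 ((M * W.period / ν) / (E.a (m + 1) * (t - (j : ℝ) * E.refresh (m + 1))))) ^ σ' :=
          add_nonneg (mul_nonneg hCmL hS0) hT0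
        exact mul_le_mul_of_nonneg_right hCmle hin0
    _ = (Cm * Lσ * (Cm * Lσ * (E.cellVisc (m + 1) ^ σ' + ((⌈K / E.cellVisc (m + 1)⌉₊ : ℝ) / E.N (m + 1)) ^ σ' + E.θ (m + 1) ^ σ'
            + ((E.N m : ℝ) / E.N (m + 1)) ^ σ')
          + (min 1 ((M * W.period / E.cellVisc (m + 1)) / (E.a (m + 1) * (t - (j : ℝ) * E.refresh (m + 1))))) ^ σ'))
        * Real.sqrt (lossFwd (Um ((j : ℝ) * E.refresh (m + 1)) t) x) * Real.sqrt (lossAdj (Um ((j : ℝ) * E.refresh (m + 1)) t) y) := by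
        rw [hνdef]; ring



end Summit.AnomalousDissipation.AnomalousDissipation.Theorems.SolenoidalFractalHomogenisation.LagrangianStep.Z7Glue

end
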